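import Literature.NumberTheory.K2Lit.SiegelDoubledUnipotent        -- ★ p855496 (D9, K2Liu-p01): `unipDelta`, `weylDelta`, `intertwiningDelta`, `constTermDelta`
import Mathlib.MeasureTheory.Measure.Haar.Basic
import Summits.HodgeConjecture.HodgeConjecture.Theorems.K2LiuConstantTermDelta   -- ★ p855642 (O41.4 file (c), K2Liu-p07 g2): `constTerm_three_cells` (pays O41.4 on write); brings ★ `eisensteinSeriesDelta`, `IsCoveringWeight`, `SiegelDeltaQuot`
import Summits.HodgeConjecture.HodgeConjecture.Theorems.K2LiuIntertwiningConverges   -- ★ p856422 (O41.3, K2Liu-p09 g2): `intertwiningConverges` (ties O41.3 BY NAME, ED. 3) = ★ p855821 (K2Liu-p06) modulo-(E5′) closer ∘ ★ p856279 `parabolicIntegral`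

/-!
# K2_Liu_CurveThetaSigs — unit U7 «CONTINUATION ORGANS of #41» (tier-1 socket module for hLiu418 = stmt-HodgeConjecture-24832)

Track B ∕ build stream 29 (`Cruxes/HLiu418/Lines/K2_Liu_*`). Planner `hodgecm-mathlib-K2Liu-plan` g0 (ED. 1),
g1 (ED. 2), 2026-09-03. INFO-ONLY companion to the #184♮ LINE `Cruxes/HLiu418/Lines/K2_Liu_CurveThetaNonOrthogonal.lean` (A-plan2,
rev. i 2395c28e7a7fc923). Socket #41 `sig_K2LiuSiegelEisensteinContinuation` (unit U6, XXL) is being paid by K2Liu-p01's ORGAN PROGRAMME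
(REPORT-FIRST `K2/K2Liu-p01/g0/REPORT-FIRST-41-SiegelEisensteinContinuation.K2Liup01g0.md` 3813d253b69f799f, organs O41.1–O41.9; glue O41.9 ★ p855332
`Theorems/K2LiuEisensteinContinuationGlue.lean`; leaf D9 ★ p855496 `K2Lit/SiegelDoubledUnipotent.lean`). The organs are count-neutral helper files
(`--supports stmt-HodgeConjecture-24832 --as helper`); this module only gives the two ANALYTIC organs NAMES OF RECORD so that they are paid BY NAME
like every other socket (prover's words win before TAKE: the bytes are the takers' REPORT-FIRST forms, verbatim).

ED. 3 (this file, K2Liu-plan (g2) 2026-09-04, TIE-ONLY edition under the LEAD's standing pre-authorisation 01:08:35Z (1)): TWO sockets, ZERO `sorry` —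
O41.3 `sig_K2LiuIntertwiningConverges` TIED BY NAME to ★ p856422 `K2LiuIntertwiningConverges.intertwiningConverges` (K2Liu-p09 (g2), commit 60dbc5f3e0cd;
= K2Liu-p06's ★ p855821 closer modulo (E5′) ∘ K2Liu-p09's ★ p856279 `parabolicIntegral`; statement bytes byte-identical to ED. 1∕2 0c464058245a7145 ∕ f2e121f519d1cdc9) and
O41.4 `sig_K2LiuConstantTermDelta` TIED BY NAME (since ED. 2) to ★ p855642 `K2LiuConstantTermDelta.constTerm_three_cells` (K2Liu-p07 (g2)); details:
* O41.3 `sig_K2LiuIntertwiningConverges` — «THE INTERTWINING INTEGRAL CONVERGES ABSOLUTELY on `Re s > n/2`»: for a continuous Siegel section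
  `f ∈ I_Δ(s, χ)` on `H(𝔸) = U(𝕍 ⊕ (−𝕍))(𝔸_{L⁺})` and ANY Haar measure `νN` on `N_Δ(𝔸)` (★ `unipDelta`), the integrand of
  `M(s)f(h) = ∫_{N_Δ(𝔸)} f(w_Δ u h) du` (★ `intertwiningDelta νN f h`) is Bochner-integrable at every `h`.  Bytes = K2Liu-p06 (g0) REPORT-FIRST (ii)
  `K2/K2Liu-p06/g0/SIGS_K2LiuIntertwiningConverges.v1.K2Liu-p06-g0.lean` 24484300a8e52eaa VERBATIM (prefix = #9's binders; LEAD 23:05:23Z: the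
  `Integrable` form is the form of record).  Road (p06): Iwasawa `H(𝔸) = P_Δ(𝔸)·K` (★ `K2LiuIwasawaDatumNonempty`), `|f(w_Δ u h)| ≤ δ(p(w_Δ u))^{Re s + n/2}·sup_K |f|`
  after moving `h` through `P_Δ = M_Δ N_Δ` (affine change of variable on `N_Δ(𝔸)`), big cell free ★ p855538 `K2LiuSiegelBigCellFree`, covering-weight
  folding ★ p855517 `K2LiuIntertwiningMajorant` + ★ p855540 `K2LiuUnipotentCoveringWeight`, and #9's Godement majorant on `Re s > n/2`.

* O41.4 `sig_K2LiuConstantTermDelta` (NEW in ED. 2) — «ORBIT FORM» of the CONSTANT TERM of the doubled Siegel Eisenstein series along `N_Δ`, THREE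
  CELLS: `∫ β(u) • E(u h; f) dνN = (∫ β dνN) • f(h) + intertwiningDelta νN f h + ∫ β(u) • Σ'_{q ∈ REST} f(γ_q u h) dνN` in covering-weight Bochner
  currency (K2Liu-p07 (g2) REPORT-FIRST 99eb0f16d8bad5ea, referee check K2Liu-ref1 23:08:44Z ✓).  Bytes = p07's SIGS v1
  `K2/K2Liu-p07/g2/SIGS_K2LiuConstantTermDelta.v1.K2Liu-p07-g2.lean` 418ed1d12d0d1316 :29–:52 VERBATIM (prefix = #9's binders + `0 < n`, then ref1's D9
  binders `[MeasurableSpace] [BorelSpace] (νN) [νN.IsHaarMeasure]`, the covering weight `β`, the rational presentation `wq` of `w_Δ`, `h`, the analytic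
  binder (H)); PAID ON WRITE by ★ p855642 `Theorems/K2LiuConstantTermDelta.constTerm_three_cells` (the proof below is p07's tie probe: `intro …; exact`).
  v2 of the organ (MID ↔ the `GL₂(𝔸_L)`-Borel Eisenstein series of the `w₁`-intertwined section, after O41.1∕B2) will be a NEW socket, never a re-type.

VACUITY ∕ DEGENERATE-CORNER DISCIPLINE (cell rules (V1)–(V8); K2Liu-ref1 D9 checklist 23:05:26Z): the measure on `N_Δ(𝔸)` is a BINDER `νN` with
`[νN.IsHaarMeasure]` under `[MeasurableSpace] [BorelSpace]` binders — `νN = 0` is EXCLUDED (a Haar measure is positive on open sets), so no «converges»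
clause is made trivial by a junk measure and no identity `0 = 0` satisfies anything here (the socket is a pure integrability claim; O41.4∕O41.5 carry the
identities and will pin `νN` by name); `n = 0`: `H = U(0,0)` and `N_Δ` are trivial, the claim is the integrability of a continuous function on a compact
group — true, harmless; (V5) the integrand `u ↦ f(w_Δ·u·h)` is continuous (`f` continuous by hypothesis, subgroup coercion and multiplication continuous),
hence (strongly) measurable — no non-measurable corner; `_hdV0 ∕ _hdW0` are carried for prefix-identity with #9 (the statement does not need them).
O41.4 corners (K2Liu-ref1 D9 checklist; p07's docstring): `νN` Haar (≠ 0) as for O41.3; `0 < n` EXPLICIT (for `n = 0` one has `w_Δ = 1 ∈ P_Δ`, the big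
cell IS the identity cell and the three-cell split is not claimed — honest); the covering weight `β` and the presentation `wq` are INHABITED binders (★
p855540 `K2LiuUnipotentCoveringWeight.exists_isCoveringWeight_unipDeltaRat_lintegral_ne_top`, ★ p855590 `weylDelta_mem_ratH` ∕ ★ p855629 `exists_wq`), so
no instance of the socket is vacuous by an empty binder; the analytic binder (H) `∫⁻ (Σ'_q ‖f(γ_q u h)‖ₑ) β dνN ≠ ∞` is a genuine hypothesis at each
`(β, h)` — supplied on `Re s > n/2` by #9's majorant + local uniformity (★ K2Liu-p06 `exists_weight_lintegral_majorant_ne_top`), and if `∫⁻ β = ∞` it forces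
`f h = 0` so the identity cell reads `0` (p07: finite mass not needed); the conclusion is an identity of three absolutely convergent Bochner integrals
(★ `three_cells_ne_top`), never `0 = 0` by junk: the left side is the `β`-independent constant term (★ `integral_wt_smul_eq_of_coveringSum_eq_one`).
HONEST LABEL: HC_CM is proved only modulo the printed citations (2 remaining named inputs: hLiu418 = stmt-HodgeConjecture-24832, h413 =
stmt-HodgeConjecture-24833) until rung 0 closes; this module is statements only (ED. 3: 2 sockets, 0 `sorry` — O41.3 and O41.4 are both
★-tied, i.e. proved elsewhere in `Theorems/` and cited by name), no proof claimed here.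
-/

noncomputable section

open scoped Matrix ENNReal
open NumberField IsDedekindDomain MeasureTheory

namespace Summit.HodgeConjecture.HodgeConjecture.Cruxes.HLiu418.K2LiuCurveThetaSigsU7ContinuationOrgans

open Literature.NumberTheory.Automorphic Literature.NumberTheory.GaloisRepresentations
open Literature.NumberTheory.GelbartRogawski1991 Literature.NumberTheory.GelbartRogawski1991.GRConstruction
open Literature.NumberTheory.K2Lit.SiegelDoubled Literature.MeasureTheory.Group

/-- **O41.3 `IntertwiningConverges`** (socket of record for organ O41.3 of #41 `sig_K2LiuSiegelEisensteinContinuation`; kind: support ∕ analytic organ;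
size M–L; TAKEN K2Liu-p06 (g0), LEAD SWAP 23:05:23Z; bytes = p06 REPORT-FIRST (ii) 24484300a8e52eaa VERBATIM; ★ PAID p856422 (K2Liu-p09 (g2), on
p06's ★ p855821) — TIED BY NAME in ED. 3, no `sorry`).
For every CM field `L`, doubled datum `(e, dV, dW)` (all `dV i`, `dW j` real and non-zero), unitary Hecke character `χ` of `L`, `s` with `n/2 < Re s`,
every CONTINUOUS Siegel section `f ∈ I_Δ(s,χ)` (★ `IsSiegelDeltaSection`), every Haar measure `νN` on `N_Δ(𝔸)` (★ `unipDelta`, Borel σ-algebra) and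
every `h ∈ H(𝔸)`: `u ↦ f(w_Δ · u · h)` is `νN`-integrable — i.e. the intertwining integral ★ `intertwiningDelta νN f h = ∫ u, f (w_Δ u h) dνN` converges
absolutely on the Godement half-plane.  CORNERS: see the module docstring (νN ≠ 0 forced by `IsHaarMeasure`; n = 0 trivial-true; integrand continuous).
WHY IT MIGHT FAIL: only through a mis-normalised exponent in ★ `siegelDeltaCharacter` (`δ^(2s+n)`) vs the abscissa `n/2` — the taker re-derives the
abscissa from #9's majorant (if the honest abscissa is larger, the prover's words win and ED. 2 re-cuts BEFORE any consumer ties).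
Sources: [MoeglinWaldspurger1995, II.1.6–II.1.7], [GelbartPiatetskishapiroRallis1987, Part A §5], [HarrisKudlaSweet1996, §6 (6.14)–(6.16)], [KudlaRallis1994, §1]. -/
theorem sig_K2LiuIntertwiningConverges :
    ∀ (L : Type) [Field L] [NumberField L] [IsCMField L] {N M n : ℕ} (e : Fin N × Fin M ≃ Fin n)
      (dV : Fin N → L) (hdV : ∀ i, IsCMField.complexConj L (dV i) = dV i) (_hdV0 : ∀ i, dV i ≠ 0)
      (dW : Fin M → L) (hdW : ∀ i, IsCMField.complexConj L (dW i) = dW i) (_hdW0 : ∀ i, dW i ≠ 0)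
      (χ : HeckeCharacter L), χ.IsUnitary →
        ∀ (s : ℂ), (n : ℝ) / 2 < s.re →
          ∀ f : HA L e dV hdV dW hdW → ℂ, IsSiegelDeltaSection L e dV hdV dW hdW χ s f → Continuous f →
            ∀ [MeasurableSpace (unipDelta L e dV hdV dW hdW)] [BorelSpace (unipDelta L e dV hdV dW hdW)]
              (νN : Measure (unipDelta L e dV hdV dW hdW)) [νN.IsHaarMeasure]
              (h : HA L e dV hdV dW hdW),
                Integrable (fun u : unipDelta L e dV hdV dW hdW =>
                  f (weylDelta L e dV hdV dW hdW * (u : HA L e dV hdV dW hdW) * h)) νN :=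
  Summit.HodgeConjecture.HodgeConjecture.Cruxes.HLiu418.K2LiuIntertwiningConverges.intertwiningConverges

/-- **O41.4 `ConstantTermDelta`** (socket of record for organ O41.4 of #41 `sig_K2LiuSiegelEisensteinContinuation`; kind: support ∕ analytic organ; size M–L;
K2Liu-p07 (g2); bytes = p07 SIGS v1 418ed1d12d0d1316 :29–:52 VERBATIM; ★ PAID ON WRITE by p855642 — TIED BY NAME, no `sorry`).
**THE CONSTANT TERM OF THE DOUBLED SIEGEL EISENSTEIN SERIES ALONG `N_Δ`, THREE CELLS («ORBIT FORM»).**  For a unitary `χ`, `Re s > n/2`, `0 < n`, a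
continuous Siegel section `f` of `I_Δ(s,χ)` (★ `IsSiegelDeltaSection`), a Haar measure `νN` on `N_Δ(𝔸)` (★ `unipDelta`, Borel binders), an
`N_Δ(L⁺)`-covering weight `β` on `N_Δ(𝔸)` (★ `IsCoveringWeight (unipDeltaRat …) β`), a rational presentation `wq ν = w_Δ ν ∈ H(L⁺)` of the big-cell orbit,
and `h ∈ H(𝔸)`, UNDER the analytic binder (H) «the majorant series `Σ_q ‖f(γ_q u h)‖` is integrable over one `β`-weighted fundamental domain of
`N_Δ(L⁺)\N_Δ(𝔸)`» (⟸ #9 + local uniformity, K2Liu-p06's (M3) ★ `exists_weight_lintegral_majorant_ne_top`):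
  `∫ β(u) • E(u h; f) dνN = (∫ β dνN) • f(h) + intertwiningDelta νN f h + ∫ β(u) • Σ'_{q ∈ REST} f(γ_q u h) dνN`,
`E = ` ★ `eisensteinSeriesDelta f`, `γ_q = Quotient.out q`, `REST = P_Δ(L⁺)\H(L⁺) ∖ ({[1]} ∪ {[w_Δ ν]})` — identity cell `vol_β · f(h)`, the FULL intertwining
integral `M(s)f(h)` (the big cell is free, ★ `K2LiuSiegelBigCellFree`), and the middle cosets carried verbatim (for `n = 2` the single rank-1 double coset;
`= E₁(s)(h)`, the `GL₂(𝔸_L)`-Borel Eisenstein series of the `w₁`-intertwined section — identified in O41.8, NOT claimed here).  The left side is the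
constant term along `N_Δ` in covering-weight currency; for the left-`N_Δ(L⁺)`-invariant `u ↦ E(u h)` it does not depend on `β`
(★ `integral_wt_smul_eq_of_coveringSum_eq_one`) and equals `vol_β · constTermDelta ν` for the invariant probability `ν` on ★ `UnipDeltaQuot` (that one-line
bridge to ★ D9's spelling is owed downstream, not here).  CORNERS: module docstring.
WHY IT MIGHT FAIL: it cannot any more — paid by ★ p855642; the only live risk was the abscissa∕exponent normalisation shared with O41.3 (binder (H) makes the
identity abscissa-free; the abscissa enters only when (H) is discharged by #9).
Sources: [MoeglinWaldspurger1995, II.1.7], [KudlaRallis1994, §2], [Tan1999, §2], [GelbartPiatetskishapiroRallis1987, Part A §2], [Garrett2018, §3.10]. -/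
theorem sig_K2LiuConstantTermDelta :
    ∀ (L : Type) [Field L] [NumberField L] [IsCMField L] {N M n : ℕ} (e : Fin N × Fin M ≃ Fin n)
      (dV : Fin N → L) (hdV : ∀ i, IsCMField.complexConj L (dV i) = dV i) (_hdV0 : ∀ i, dV i ≠ 0)
      (dW : Fin M → L) (hdW : ∀ i, IsCMField.complexConj L (dW i) = dW i) (_hdW0 : ∀ i, dW i ≠ 0)
      (χ : HeckeCharacter L), χ.IsUnitary →
        ∀ (s : ℂ), (n : ℝ) / 2 < s.re → 0 < n →
          ∀ f : HA L e dV hdV dW hdW → ℂ, IsSiegelDeltaSection L e dV hdV dW hdW χ s f → Continuous f →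
            ∀ [MeasurableSpace (unipDelta L e dV hdV dW hdW)] [BorelSpace (unipDelta L e dV hdV dW hdW)]
              (νN : Measure (unipDelta L e dV hdV dW hdW)) [νN.IsHaarMeasure]
              (β : unipDelta L e dV hdV dW hdW → ℝ≥0∞), IsCoveringWeight (unipDeltaRat L e dV hdV dW hdW) β →
              ∀ (wq : unipDeltaRat L e dV hdV dW hdW → ratH L e dV hdV dW hdW),
                (∀ ν, ((wq ν : ratH L e dV hdV dW hdW) : HA L e dV hdV dW hdW) =
                  weylDelta L e dV hdV dW hdW * ((ν : unipDelta L e dV hdV dW hdW) : HA L e dV hdV dW hdW)) →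
              ∀ (h : HA L e dV hdV dW hdW),
                ∫⁻ u, (∑' q : SiegelDeltaQuot L e dV hdV dW hdW,
                  ‖f ((((Quotient.out q : ratH L e dV hdV dW hdW) : HA L e dV hdV dW hdW)) * ((u : HA L e dV hdV dW hdW) * h))‖ₑ) * β u ∂νN ≠ ∞ →
                ∫ u, (β u).toReal • eisensteinSeriesDelta L e dV hdV dW hdW f ((u : HA L e dV hdV dW hdW) * h) ∂νN =
                  (∫ u, (β u).toReal ∂νN) • f h + intertwiningDelta L e dV hdV dW hdW νN f h +
                    ∫ u, (β u).toReal • (∑' q : ↥(({Quotient.mk (MulAction.orbitRel (siegelDeltaRat L e dV hdV dW hdW) (ratH L e dV hdV dW hdW)) 1} ∪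
                        Set.range (fun ν : unipDeltaRat L e dV hdV dW hdW =>
                          (Quotient.mk (MulAction.orbitRel (siegelDeltaRat L e dV hdV dW hdW) (ratH L e dV hdV dW hdW)) (wq ν) :
                            SiegelDeltaQuot L e dV hdV dW hdW)))ᶜ : Set (SiegelDeltaQuot L e dV hdV dW hdW)),
                      f ((((Quotient.out (q : SiegelDeltaQuot L e dV hdV dW hdW) : ratH L e dV hdV dW hdW) : HA L e dV hdV dW hdW)) *
                        ((u : HA L e dV hdV dW hdW) * h))) ∂νN := by
  -- TIED BY NAME (p07's tie probe, SIGS v1): ★ p855642 `K2LiuConstantTermDelta.constTerm_three_cells`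
  intro L _ _ _ N M n e dV hdV _ dW hdW _ χ _ s _ hn f hf hfc _ _ νN _ β hβ wq hwq h hH
  exact K2LiuConstantTermDelta.constTerm_three_cells wq hwq hn νN hβ hf hfc h hH

end Summit.HodgeConjecture.HodgeConjecture.Cruxes.HLiu418.K2LiuCurveThetaSigsU7ContinuationOrgans

end
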